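import Mathlib
import Summits.PneNP.PneNP.Theorems.ConvexRankGatesConvexGateBlindColumnSpaceHalf
import Summits.PneNP.PneNP.Theorems.ConvexRankGatesConvexGateBlindL1Linear

/-!
# PneNP / ConvexRankGates — `ConvexGateBlind`: the column-space LP slice in the WHOLE range `δ < 1/2`, UNCONDITIONALLY

Helpers (`--supports stmt-PneNP-10680`), COLUMN-SPACE line (prover seat 2, session 19). Session 16 proved the column-space
(restricted non-negative rank) LP slice of the crux for every `δ ∈ (0,1/2)` CONDITIONALLY on Montgomery's fractional
clique-decomposition theorem (`…ColumnSpaceHalf`, hypothesis `MontgomeryFractionalCliqueDecomposition`), the only use of the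
hypothesis being the linear ℓ₁-constant `abs_sum_le_linear_of_montgomery`. Session 19 proves that ℓ₁-bound unconditionally
(`…L1Linear.abs_sum_le_linear`, via the pool measure), so the theorem holds outright: for every `δ ∈ (0,1/2)` and every `c`,
eventually in `m`, for every `ε > 0` and every `R ≤ m^c`, no identity `cdist Q u − ε = ∑_{l<R} b_l(u)·t_l(E(Q))` with
`b ≥ 0` and `k`-clique-non-negative edge weightings `t_l` holds on all `k`-sets `Q` and all `k`-clique-free `u`
(`columnSpace_cliqueDistConeRankHard_half`, registered stub `columnSpace_crux_half`). The asymptotics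
(`eventually_catch_exponent_linear_var`) are reused from `…ColumnSpaceHalf`. [new]
-/

set_option linter.dupNamespace false

namespace Summit.PneNP.PneNP.Theorems

open Finset Real Filter Literature.Computability.Complexity
open Summit.PneNP.PneNP.Cruxes.ConvexGateBlind.StrictRankConicCover (Edge cdist)

noncomputable section

/-! ## The unconditional eventual form -/

/-- **The column-space LP slice of the crux holds for EVERY `δ ∈ (0, 1/2)` — the whole range of the crux — UNCONDITIONALLY.** For every `δ ∈ (0,1/2)` and every `c`: eventually in `m` (`k = ⌈m^δ⌉₊`), for every `ε > 0`, every `R ≤ m^c`, all `b ≥ 0` and all `k`-clique-non-negative `t₁,…,t_R`, the identity `cdist Q u − ε = ∑_l b_l(u)·t_l(E(Q))` FAILS for some `k`-set `Q` and some `k`-clique-free `u`.** [new] -/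
theorem columnSpace_cliqueDistConeRankHard_half {δ : ℝ} (hδ0 : 0 < δ) (hδ1 : δ < 1 / 2) (c : ℕ) :
    ∀ᶠ m : ℕ in atTop, ∀ ε : ℝ, 0 < ε → ∀ R : ℕ, R ≤ m ^ c →
      ∀ (t : Fin R → Edge m → ℝ) (b : (Edge m → Bool) → Fin R → ℝ),
      (∀ l (Q : Finset (Fin m)), Q.card = ⌈(m : ℝ) ^ δ⌉₊ → 0 ≤ ∑ e, if cliqueVec Q e = true then t l e else 0) →
      (∀ u l, 0 ≤ b u l) →
      ¬ ∀ (Q : Finset (Fin m)) (u : Edge m → Bool), Q.card = ⌈(m : ℝ) ^ δ⌉₊ → cliqueFn m ⌈(m : ℝ) ^ δ⌉₊ u = false →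
          cdist Q u - ε = ∑ l, b u l * ∑ e, (if cliqueVec Q e = true then t l e else 0) := by
  filter_upwards [eventually_catch_exponent_linear_var hδ0 hδ1 c] with m hm
  obtain ⟨hkB, hkm, hsq, hsmall⟩ := hm
  intro ε hε R hR t b ht hb hall
  set k : ℕ := ⌈(m : ℝ) ^ δ⌉₊ with hk
  have hk4 : 4 ≤ k := by omega
  have hkm2 : k + 2 ≤ m := by nlinarith
  have hkR : (4 : ℝ) ≤ k := by exact_mod_cast hk4
  have hL1 : (1 : ℝ) ≤ 400 * (k : ℝ) - 1 := by nlinarith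
  have hLq : (k : ℝ) - 1 ≤ 12 * (400 * (k : ℝ) - 1) := by nlinarith
  set θ : ℝ := Real.exp (-(((k : ℝ) - 1) * ((m : ℝ) - 1) / (2304 * k * (400 * (k : ℝ) - 1) ^ 2))) +
    Real.exp (-(1 / (5200 * Real.sqrt (2 * (k : ℝ) * ((k : ℝ) - 2) / ((m : ℝ) - k - 1))))) with hθ
  have hlb := restricted_terms_lower_bound_of_catch (by omega) hkm2 t ht b hb ε hε hall θ
    (fun w hw => by
      have h := card_badColourings_le_var hk4 hsq (400 * (k : ℝ) - 1) hL1 hLq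
        (fun v hv => abs_sum_le_linear hk4 (by omega) v hv) w hw
      rw [hθ, mul_add]
      exact h)
  have hθ0 : 0 < θ := by rw [hθ]; positivity
  have hq3 : (3 : ℝ) ≤ ((k - 1 : ℕ) : ℝ) := by
    have : 3 ≤ k - 1 := by omega
    exact_mod_cast this
  set qm : ℝ := ((k - 1 : ℕ) : ℝ) ^ m with hqm
  have hqm0 : 0 < qm := by rw [hqm]; positivity
  have hq_le : ((k - 1 : ℕ) : ℝ) ≤ qm / 2 := by
    obtain ⟨m', hm'⟩ : ∃ m', m = m' + 2 := ⟨m - 2, by omega⟩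
    rw [hqm, hm', pow_succ, pow_succ]
    have h1 : (1 : ℝ) ≤ ((k - 1 : ℕ) : ℝ) ^ m' := one_le_pow₀ (by linarith)
    have hQ0 : (0 : ℝ) ≤ ((k - 1 : ℕ) : ℝ) := by positivity
    have h2 := mul_le_mul h1 hq3 (by norm_num) (by positivity)
    have h3 := mul_le_mul_of_nonneg_right h2 hQ0
    linarith
  have hRθ : (R : ℝ) * (qm * θ) ≤ qm / 4 := by
    have hR' : (R : ℝ) ≤ (m : ℝ) ^ c := by exact_mod_cast hR
    calc (R : ℝ) * (qm * θ) ≤ (m : ℝ) ^ c * (qm * θ) := mul_le_mul_of_nonneg_right hR' (by positivity)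
      _ = qm * ((m : ℝ) ^ c * θ) := by ring
      _ ≤ qm * (1 / 4) := mul_le_mul_of_nonneg_left hsmall hqm0.le
      _ = qm / 4 := by ring
  linarith

/-- **The column-space LP slice of the crux, every `δ < 1/2`, unconditionally** (registered form of
`columnSpace_cliqueDistConeRankHard_half`; the statement of `columnSpace_crux_half_of_montgomery` without the hypothesis). [new] -/
theorem columnSpace_crux_half : ∀ (δ : ℝ), 0 < δ → δ < 1 / 2 → ∀ c : ℕ, ∀ᶠ m : ℕ in Filter.atTop, ∀ ε : ℝ, 0 < ε → ∀ R : ℕ, R ≤ m ^ c → ∀ (t : Fin R → Edge m → ℝ) (b : (Edge m → Bool) → Fin R → ℝ), (∀ l (Q : Finset (Fin m)), Q.card = ⌈(m : ℝ) ^ δ⌉₊ → 0 ≤ ∑ e, if cliqueVec Q e = true then t l e else 0) → (∀ u l, 0 ≤ b u l) → ¬ ∀ (Q : Finset (Fin m)) (u : Edge m → Bool), Q.card = ⌈(m : ℝ) ^ δ⌉₊ → cliqueFn m ⌈(m : ℝ) ^ δ⌉₊ u = false → cdist Q u - ε = ∑ l, b u l * ∑ e, (if cliqueVec Q e = true then t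 l e else 0) :=
  fun _ hδ0 hδ1 c => columnSpace_cliqueDistConeRankHard_half hδ0 hδ1 c

end

end Summit.PneNP.PneNP.Theorems
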